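import Summits.QuantumFields.YangMills.Theorems.UnitScaleTiltProp8HalvingSliceMultiplier
import Summits.QuantumFields.YangMills.Theorems.UnitScaleTiltProp8FlatPullbackDictionary
import Literature.MathematicalPhysics.QuantumFieldTheory.Balaban1983to89.B8Eq191FlatStencils
import HarnessLib

/-!
# Route `UnitScaleTilt`, crux K1 child «MinimiserStabilityRegPr» (stmt-QuantumFields-19200), registered stub V2′ `stub_halvingStep`
# (skeletons v8 5b4e846794b80374 ∕ v10 `BirthV10`) — **THE F2↔P2 DICTIONARY FOR THE SLICE (153): [B8] (1.38) «R(U₀)D^{η*}_{U₀}A = 0» AT `U₀ = 1`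
# IN THE LITERATURE'S MULTIPLIER FORM ON THE PERIODIC PULLBACK ⟹ THE MATRIX-MULTIPLIER FORM IN P2'S LETTERS ON THE TORUS**
# (owner W-SEAT MAP #3 row M3 ∕ ASSIGNMENTS 9 (b) 05:01:42Z «the F2↔P2 dictionary for `Q′`∕`Δ^η` at U₀ = 1 is inside your row»; predecessor
# ★w3-19200 g3 HANDOFF successor item (1))

Cell `ym3-torus` (HUMAN RULING D-0037, YM ladder rung R3 — continuum SU(2) YM₃ on the torus is a RUNG, not the Clay problem), width seat
`ym-ust-19200-w7` gen 0 (D-0154 (3c)).  `--supports stmt-QuantumFields-19200 --as helper`; def-free, 0 sorry, standard axioms.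

WHY.  Hypothesis (ii) of ✓ p603846 `HalvingA1Row165TraceAnyW.row165_of_tracePairing_L5_anyW` — the slice of the chart field, [Balaban1985Variational] p. 301
(153) *«Rd^{η*}A = 0, where the operator R is defined for the sequence {Ω″_j}»* — is accepted by ✓ p604322 `HalvingSliceMultiplier.slice_of_matrixMultiplier` in
the MATRIX-MULTIPLIER FORM `∃ μ : 𝔅 → 𝔤, ∀ s, Δ(∂*A)(s) = Σ_{i ∈ 𝔅} (Q′_{j(i)}e_s)(i)•μ(i)` written in P2's letters ([Balaban1984PropagatorsII] Sect. A on the torus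
`T_η = Site P 0`: `LatticeFieldCalculus.laplace ∕ diverg ∕ siteAvgIter`, index set `B6SectAOperatorsV1.SiteIdx D`, lattice factor `η⁻¹`).  The Literature
states [B8] (1.38) — the (1.38) conjunct of Theorem 2's conclusion, `B8Thm2SetupTorus.Concl2Setup` — on the `ℤᵈ` carriers in the multiplier form
`B8Eq138LandauZd.IsLandau138 L m η Ω₀ Λs U₀ A♯ := ∃ μ, ∀ x ∈ Ω₀, Δ^η_{U₀}↾Ω₀(D^{η*}_{U₀}A♯)(x) = (Q′(U₀)ᵀμ)(x)` read on the PERIODIC PULLBACK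
`A♯ = B10Eq27TorusAxialLog.pull A 0` (`Ω₀ = univ` for an all-torus level-`0` domain, print's `Ω″₀ = T`).  THIS FILE is the dictionary between the two at the flat
background `U₀ = 1` for an ARBITRARY nested family `D : Domains P` (so in particular for the cube sequence `cubeSeqMT3` of (144)): with the constraint tower
`Λs j := {y ∈ ℤᵈ | (0 + y) ∈ Λ_j}` (the `ℤᵈ`-labels of P2's `D.LamSite j`), `IsLandau138 P.L D.k η univ Λs 1 (pull A 0)` IMPLIES the matrix-multiplier form —
so the (153) conjunct of the displayed pillar P1 (`HalvingChartP1Display.package_rows_of_P1disp`'s `hP1`) is dischargeable from a Theorem-2 interface AT THE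
CUBE MEMBER stated in lit-balaban's own letters (`IsLandau138 … (pull A 0)`, as in `Concl2Setup`).

WHAT THIS FILE PROVES (every `P : Params`, `𝔸 = M_N(ℂ)`; no definition, no sorry):
* §1 THE FLAT STENCILS UNDER THE PERIODIC PULLBACK (base point `0`): `covDivB_one_pull` (`D^{η*}_1 A♯ = (∂*A)♯`, `∂* = diverg η⁻¹`), `covLap_one_comp_transl`
  (`Δ^η_1 (f♯) = (Δf)♯`, `Δ = laplace η⁻¹`), `covLap_covDivB_one_pull` (`Δ^η_1D^{η*}_1A♯ = (Δ∂*A)♯`).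
* §2 LABELS: `transl_zero_valLabels` (`0 + labels(y) = y` at every level), `blockMap_pow_valLabels` (`⌊labels(x)∕Lʲ⌋ = labels(Bʲx)`, standing range),
  `QT_one_valLabels` (the flat transpose `Q′(1)ᵀμ` at the labels of `x` = `Σ_{j ≤ k} L^{−dj}·𝟙[Bʲx ∈ Λ_j]·μ_j(labels(Bʲx))`).
* §3 THE TORUS SIDE: `siteAvgIter_single` (`(Q′_j e_s)(y) = L^{−dj}·𝟙[Bʲs = y]`), `sum_siteIdx_single_smul` (`Σ_{i∈𝔅}(Q′_{j(i)}e_s)(i)•ν(i) = Σ_{j ≤ k}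
  L^{−dj}·𝟙[Bʲs ∈ Λ_j]·ν(j, Bʲs)`).
* §4 ★★ **`sliceMultiplier_of_isLandau138_pull`** — the dictionary: `IsLandau138 P.L D.k η univ (fun j => {y | D.LamSite j (transl 0 y)}) 1 (pull A 0)` ⟹
  `∃ μ : SiteIdx D → M_N(ℂ), ∀ s, laplace η⁻¹ (diverg η⁻¹ A) s = Σ_i siteAvgIter i.1.1 (Pi.single s 1) i.1.2 • μ i`; and at the d = 3 carrier with `η = L^{−(K−n)}`,
  ★★ **`slice_of_isLandau138_pull_T3`**: the same ⟹ `∀ φ, RE D L^{K−n} (dsE L^{K−n} (toLp (φ∘A))) = 0` (∘ `slice_of_matrixMultiplier`) — hypothesis (ii) itself.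
HONEST SCOPE.  Bookkeeping over landed identities (`B8Eq191FlatStencils.covLap_flat_apply ∕ QT_flat_apply`, `Prop8PullbackDict.covDeriv_flat_apply`,
`B5Eq118OneStroke.val_iterBlockOf ∕ siteAvgIter_eq_blockSum`); flat background only (the curved dictionary `Q′(U₀)` ↔ a tree average is NOT attempted — cf. the
banked M10(b) letter of ★w4-19200 g2 for the BOND average, which does not enter here: (153) constrains gauge FUNCTIONS through the SITE averages `Q′`); the converse
implication is not needed and not stated.  NOT a claim about [B8] Theorem 2, the stub, the crux, the rung or the mass gap.

References: T. Bałaban, CMP **99** (1985) 75–102 [Balaban1985RegularSpaces] (1.1) p.76, (1.29) p.81, (1.38) p.82, Thm 2 p.83; CMP **96** (1984) 223–250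
[Balaban1984PropagatorsII] (2.7)–(2.8) p.224, (2.10)–(2.15) p.225; CMP **99** (1985) 389–434 [Balaban1985BackgroundPropagators] (3.19) p.393, (3.23)–(3.25) p.394;
CMP **102** (1985) 277–309 [Balaban1985Variational] (153) p.301.
-/

set_option autoImplicit false

noncomputable section

open scoped BigOperators Matrix.Norms.L2Operator

namespace Summit.QuantumFields.YangMills.Theorems.HalvingSliceDictionary

open Literature.MathematicalPhysics.QuantumFieldTheory.Balaban1983to89
open Literature.MathematicalPhysics.QuantumLattice (blockMap)
open B5Eq118OneStroke (iterBlockOf iterBlock mem_iterBlock val_iterBlockOf siteAvgIter_eq_blockSum)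
open B6SectADomainsV1 (Domains)
open B6SectAOperatorsV1 (SiteIdx RE dsE)
open B7Prop1Explicit (e)
open B8Eq138LandauZd (IsLandau138 covDivB covLap QT)
open B8Eq191FlatStencils (covLap_flat_apply QT_flat_apply)
open B10Eq27TorusAxialLog (pull transl transl_apply transl_add_e transl_sub_e pull_apply)
open LatticeFieldCalculus (laplace diverg siteAvgIter)
open T3ContinuumYM3Torus (T3Family)
open Prop8PullbackDict (covDeriv_flat_apply)
open HalvingSliceMultiplier (slice_of_matrixMultiplier)

variable {P : Params} {N : ℕ}

/-! ## §1 The flat stencils under the periodic pullback -/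

section Stencils

/-- **`D^{η*}_1 A♯ = (∂*A)♯`**: the flat covariant divergence ((1.1)₂ summed) of the periodic pullback `A♯ = pull A 0` is the pullback of the torus divergence
`diverg η⁻¹ A`. [cite: Balaban1985RegularSpaces, (1.1) p.76, (1.38) p.82; Balaban1984PropagatorsII, (2.8) p.224] -/
theorem covDivB_one_pull (η : ℝ) (A : PBond P 0 → Matrix (Fin N) (Fin N) ℂ) (z : B7Prop1Explicit.Site P.d) :
    covDivB η (1 : B7Prop1Explicit.Site P.d → Fin P.d → (Matrix (Fin N) (Fin N) ℂ)ˣ) (pull A 0) z = diverg η⁻¹ A (transl 0 z) := by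
  unfold covDivB diverg
  refine Finset.sum_congr rfl fun μ _ => ?_
  have h := covDeriv_flat_apply (P := P) η μ (fun x : Site P 0 => A ⟨x, μ⟩) z
  exact h

/-- **`Δ^η_1(f♯) = (Δf)♯`**: the flat covariant Laplacian ((3.23) at `U = 1`) of the pullback of a torus site function is the pullback of the torus Laplacian
`laplace η⁻¹ f`. [cite: Balaban1985BackgroundPropagators, (3.23) p.394; Balaban1984PropagatorsI, (1.21) p.21] -/
theorem covLap_one_comp_transl (η : ℝ) (f : Site P 0 → Matrix (Fin N) (Fin N) ℂ) (z : B7Prop1Explicit.Site P.d) :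
    covLap η (1 : B7Prop1Explicit.Site P.d → Fin P.d → (Matrix (Fin N) (Fin N) ℂ)ˣ) (fun w => f (transl 0 w)) z = laplace η⁻¹ f (transl 0 z) := by
  rw [covLap_flat_apply]
  unfold laplace
  refine Finset.sum_congr rfl fun μ _ => ?_
  rw [transl_add_e, transl_sub_e, inv_pow, two_smul]

/-- **`Δ^η_1 D^{η*}_1 A♯ = (Δ∂*A)♯`** (the left side of (1.38) at `U₀ = 1`, `Ω₀ = T`). [cite: Balaban1985RegularSpaces, (1.38) p.82; Balaban1985BackgroundPropagators, (3.23) p.394] -/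
theorem covLap_covDivB_one_pull (η : ℝ) (A : PBond P 0 → Matrix (Fin N) (Fin N) ℂ) (z : B7Prop1Explicit.Site P.d) :
    covLap η (1 : B7Prop1Explicit.Site P.d → Fin P.d → (Matrix (Fin N) (Fin N) ℂ)ˣ)
        (covDivB η (1 : B7Prop1Explicit.Site P.d → Fin P.d → (Matrix (Fin N) (Fin N) ℂ)ˣ) (pull A 0)) z =
      laplace η⁻¹ (diverg η⁻¹ A) (transl 0 z) := by
  have h : covDivB η (1 : B7Prop1Explicit.Site P.d → Fin P.d → (Matrix (Fin N) (Fin N) ℂ)ˣ) (pull A 0) = fun w => diverg η⁻¹ A (transl 0 w) :=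
    funext (covDivB_one_pull η A)
  rw [h, covLap_one_comp_transl]

end Stencils

/-! ## §2 Labels: `0 + labels(y) = y`, `⌊labels(x)∕Lʲ⌋ = labels(Bʲx)`, and the flat `Q′(1)ᵀ` at the labels -/

section Labels

/-- **THE LABELS SECTION OF `transl 0`**: translating the origin of `T^{(j)}` by the `val`-labels of `y` gives back `y`. [folklore]
[cite: Balaban1984PropagatorsII, (2.1) p.224, dictionary] -/
theorem transl_zero_valLabels {j : ℕ} (y : Site P j) : transl (0 : Site P j) (fun ν => ((y ν).val : ℤ)) = y := by
  funext ν
  rw [transl_apply, Int.cast_natCast, ZMod.natCast_zmod_val]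
  exact zero_add (y ν)

/-- **`⌊labels(x)∕Lʲ⌋ = labels(Bʲx)`** coordinatewise (standing range `j ≤ m + K`; both lineages label blocks by integer division, `B5Eq118OneStroke.val_iterBlockOf`).
[cite: Balaban1984PropagatorsI, (1.6) p.18, (1.18) p.20; Balaban1985Averaging, (3) p.17] -/
theorem blockMap_pow_valLabels {j : ℕ} (hj : j ≤ P.m + P.K) (x : Site P 0) :
    blockMap (P.L ^ j) (fun ν => ((x ν).val : ℤ)) = fun ν => (((iterBlockOf j x) ν).val : ℤ) := by
  funext ν
  show ((x ν).val : ℤ) / ((P.L ^ j : ℕ) : ℤ) = (((iterBlockOf j x) ν).val : ℤ)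
  rw [val_iterBlockOf j hj x ν, Int.natCast_div]

/-- **THE FLAT TRANSPOSE `Q′(1)ᵀμ` AT THE LABELS OF A TORUS SITE** for the constraint tower `Λs j = {y | (0 + y) ∈ Λ_j}` of a nested family `D`:
`(Q′(1)ᵀμ)(labels x) = Σ_{j ≤ k} L^{−dj}·𝟙[Bʲx ∈ Λ_j]·μ_j(labels(Bʲx))`. [cite: Balaban1985BackgroundPropagators, (3.19) p.393, (3.24) p.394; Balaban1985RegularSpaces, (1.29) p.81] -/
theorem QT_one_valLabels (D : Domains P) (μ : ℕ → B7Prop1Explicit.Site P.d → Matrix (Fin N) (Fin N) ℂ) (x : Site P 0) :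
    QT P.L D.k (fun j => {y : B7Prop1Explicit.Site P.d | D.LamSite j (transl (0 : Site P j) y)})
        (1 : B7Prop1Explicit.Site P.d → Fin P.d → (Matrix (Fin N) (Fin N) ℂ)ˣ) μ (fun ν => ((x ν).val : ℤ)) =
      ∑ j ∈ Finset.range (D.k + 1),
        if D.LamSite j (iterBlockOf j x) then (((P.L : ℝ) ^ P.d)⁻¹) ^ j • μ j (fun ν => (((iterBlockOf j x) ν).val : ℤ)) else 0 := by
  rw [QT_flat_apply]
  refine Finset.sum_congr rfl fun j hj => ?_
  have hjk : j ≤ P.m + P.K := (Nat.lt_succ_iff.1 (Finset.mem_range.1 hj)).trans D.hk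
  rw [blockMap_pow_valLabels hjk]
  by_cases hl : D.LamSite j (iterBlockOf j x)
  · have hmem : (fun ν => (((iterBlockOf j x) ν).val : ℤ)) ∈ {y : B7Prop1Explicit.Site P.d | D.LamSite j (transl (0 : Site P j) y)} := by
      show D.LamSite j (transl (0 : Site P j) (fun ν => (((iterBlockOf j x) ν).val : ℤ)))
      rw [transl_zero_valLabels]; exact hl
    rw [Set.indicator_of_mem hmem, if_pos hl]
  · have hnmem : (fun ν => (((iterBlockOf j x) ν).val : ℤ)) ∉ {y : B7Prop1Explicit.Site P.d | D.LamSite j (transl (0 : Site P j) y)} := by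
      show ¬ D.LamSite j (transl (0 : Site P j) (fun ν => (((iterBlockOf j x) ν).val : ℤ)))
      rw [transl_zero_valLabels]; exact hl
    rw [Set.indicator_of_notMem hnmem, if_neg hl, smul_zero]

end Labels

/-! ## §3 The torus side: `(Q′_j e_s)(y)` and the sum over the site index set `𝔅` -/

section Torus

/-- **`(Q′_j e_s)(y) = L^{−dj}·𝟙[Bʲs = y]`** (the `j`-fold site average of the indicator of a fine site; standing range).
[cite: Balaban1984PropagatorsI, (1.20) p.20; Balaban1984PropagatorsII, (2.14) p.225] -/
theorem siteAvgIter_single {j : ℕ} (hj : j ≤ P.m + P.K) (s : Site P 0) (y : Site P j) :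
    siteAvgIter j (Pi.single s (1 : ℝ)) y = if iterBlockOf j s = y then (((P.L : ℝ) ^ P.d) ^ j)⁻¹ else 0 := by
  rw [siteAvgIter_eq_blockSum j hj, Finset.sum_pi_single']
  by_cases h : iterBlockOf j s = y
  · rw [if_pos h, if_pos ((mem_iterBlock j y s).2 h), smul_eq_mul, mul_one]
  · rw [if_neg h, if_neg (fun hm => h ((mem_iterBlock j y s).1 hm)), smul_zero]

/-- **THE SUM OVER `𝔅` AGAINST `Q′e_s` COLLAPSES TO THE BLOCK ANCESTORS OF `s`**: for any `ν : 𝔅 → V`,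
`Σ_{i ∈ 𝔅} (Q′_{j(i)}e_s)(i)•ν(i) = Σ_{j ≤ k} 𝟙[Bʲs ∈ Λ_j]·L^{−dj}•ν(j, Bʲs)`. [cite: Balaban1984PropagatorsII, (2.14)-(2.15) p.225] -/
theorem sum_siteIdx_single_smul (D : Domains P) {V : Type*} [AddCommGroup V] [Module ℝ V]
    (ν : (j : ℕ) → Site P j → V) (s : Site P 0) :
    ∑ i : SiteIdx D, siteAvgIter (i.1.1 : ℕ) (Pi.single s (1 : ℝ)) i.1.2 • ν i.1.1 i.1.2 =
      ∑ j ∈ Finset.range (D.k + 1), if D.LamSite j (iterBlockOf j s) then (((P.L : ℝ) ^ P.d) ^ j)⁻¹ • ν j (iterBlockOf j s) else 0 := by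
  -- from the subtype `𝔅` to the sigma type, then to the iterated sum
  let G : ((j : Fin (D.k + 1)) × Site P (j : ℕ)) → V := fun p => siteAvgIter (p.1 : ℕ) (Pi.single s (1 : ℝ)) p.2 • ν p.1 p.2
  have h1 : ∑ i : SiteIdx D, G i.1 = ∑ p : (j : Fin (D.k + 1)) × Site P (j : ℕ), if D.LamSite p.1 p.2 then G p else 0 := by
    rw [← Finset.sum_filter]
    exact (Finset.sum_subtype (Finset.univ.filter fun p : (j : Fin (D.k + 1)) × Site P (j : ℕ) => D.LamSite p.1 p.2) (fun p => by simp) G).symm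
  show ∑ i : SiteIdx D, G i.1 = _
  rw [h1, Fintype.sum_sigma, Finset.sum_range (fun j => if D.LamSite j (iterBlockOf j s) then (((P.L : ℝ) ^ P.d) ^ j)⁻¹ • ν j (iterBlockOf j s) else 0)]
  refine Finset.sum_congr rfl fun j _ => ?_
  have hj : (j : ℕ) ≤ P.m + P.K := (Nat.lt_succ_iff.1 j.isLt).trans D.hk
  rw [Finset.sum_eq_single (iterBlockOf (j : ℕ) s)]
  · show (if D.LamSite (j : ℕ) (iterBlockOf (j : ℕ) s) then siteAvgIter (j : ℕ) (Pi.single s (1 : ℝ)) (iterBlockOf (j : ℕ) s) • ν j (iterBlockOf (j : ℕ) s) else 0) = _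
    rw [siteAvgIter_single hj, if_pos rfl]
  · intro y _ hy
    show (if D.LamSite (j : ℕ) y then siteAvgIter (j : ℕ) (Pi.single s (1 : ℝ)) y • ν j y else 0) = 0
    rw [siteAvgIter_single hj, if_neg (Ne.symm hy), zero_smul, ite_self]
  · intro h; exact absurd (Finset.mem_univ _) h

end Torus

/-! ## §4 The dictionary -/

section Dictionary

/-- ★★ **[B8] (1.38) AT `U₀ = 1` ON THE PERIODIC PULLBACK ⟹ THE MATRIX-MULTIPLIER FORM OF THE SLICE IN P2'S LETTERS.**  For a nested family `D` on the torus
`T_η = Site P 0` and an `M_N(ℂ)`-valued one-form `A`: if `IsLandau138 L k η univ Λs 1 A♯` holds for `A♯ = pull A 0` with the constraint tower `Λs j = {y | (0 + y) ∈ Λ_j}`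
(the literature's multiplier form `∃ μ, ∀ x, Δ^η_1(D^{η*}_1A♯)(x) = (Q′(1)ᵀμ)(x)`), then `Δ(∂*A)(s) = Σ_{i ∈ 𝔅} (Q′_{j(i)}e_s)(i)•μ′(i)` for the torus multiplier
`μ′(j, y) := μ_j(labels y)` (`Δ = laplace η⁻¹`, `∂* = diverg η⁻¹`, `Q′_j = siteAvgIter j`) — the input of `HalvingSliceMultiplier.slice_of_matrixMultiplier` when
`η⁻¹ = L^{K−n}`. [cite: Balaban1985RegularSpaces, (1.38) p.82, (1.29) p.81; Balaban1984PropagatorsII, (2.12)-(2.15) p.225; Balaban1985BackgroundPropagators, (3.24)-(3.25) p.394; Balaban1985Variational, (153) p.301] -/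
theorem sliceMultiplier_of_isLandau138_pull (D : Domains P) (η : ℝ) {A : PBond P 0 → Matrix (Fin N) (Fin N) ℂ}
    (hLan : IsLandau138 P.L D.k η (Set.univ : Set (B7Prop1Explicit.Site P.d)) (fun j => {y : B7Prop1Explicit.Site P.d | D.LamSite j (transl (0 : Site P j) y)})
      (1 : B7Prop1Explicit.Site P.d → Fin P.d → (Matrix (Fin N) (Fin N) ℂ)ˣ) (pull A 0)) :
    ∃ μ : SiteIdx D → Matrix (Fin N) (Fin N) ℂ, ∀ s : Site P 0,
      laplace η⁻¹ (diverg η⁻¹ A) s = ∑ i : SiteIdx D, siteAvgIter (i.1.1 : ℕ) (Pi.single s (1 : ℝ)) i.1.2 • μ i := by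
  obtain ⟨μ, hμ⟩ := hLan
  refine ⟨fun i => μ (i.1.1 : ℕ) (fun ν => (((i.1.2) ν).val : ℤ)), fun s => ?_⟩
  -- the literature's identity at the labels of `s`
  have h := hμ (fun ν => ((s ν).val : ℤ)) (Set.mem_univ _)
  rw [Set.indicator_univ, covLap_covDivB_one_pull, transl_zero_valLabels, QT_one_valLabels] at h
  rw [h, sum_siteIdx_single_smul D (fun j y => μ j (fun ν => ((y ν).val : ℤ))) s]
  refine Finset.sum_congr rfl fun j _ => ?_
  split_ifs with hl
  · rw [inv_pow]
  · rfl

end Dictionary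

/-! ## §5 At the d = 3 carrier: hypothesis (ii) of the (165)-A₁ row from the literature's (1.38) on the pullback -/

section Carrier

variable {F : T3Family} {n K : ℕ}

/-- `η⁻¹ = L^{K−n}` for `η = (L⁻¹)^{K−n}`. [folklore] -/
theorem inv_invPow_eq (L : ℝ) (k : ℕ) : ((L⁻¹) ^ k)⁻¹ = L ^ k := by
  rw [inv_pow, inv_inv]

/-- ★★ **THE SLICE (ii) OF THE (165)-A₁ ROW FROM [B8] (1.38) ON THE PULLBACK** (d = 3 carrier, `η = L^{−(K−n)}`, any nested family `D` of the member `F.P K` — in particular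
the cube sequence `cubeSeqMT3` of (144)): `IsLandau138 L D.k η univ Λs 1 (pull A 0)` ⟹ `∀ φ, RE D L^{K−n} (dsE L^{K−n} (toLp (φ∘A))) = 0` — hypothesis (ii) of
`HalvingA1Row165TraceAnyW.row165_of_tracePairing_L5_anyW` ∕ the `hA` of `HalvingChartP1Display.slice_of_chartPreimage`, for every `ℝ`-linear reading `φ`.
[cite: Balaban1985RegularSpaces, (1.38) p.82, Thm 2 p.83; Balaban1984PropagatorsII, (2.12) p.225; Balaban1985Variational, (153) p.301] -/
theorem slice_of_isLandau138_pull_T3 (D : Domains (F.P K)) {A : PBond (F.P K) 0 → Matrix (Fin 2) (Fin 2) ℂ}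
    (hLan : IsLandau138 (F.P K).L D.k (((F.L : ℝ)⁻¹) ^ (K - n)) (Set.univ : Set (B7Prop1Explicit.Site (F.P K).d))
      (fun j => {y : B7Prop1Explicit.Site (F.P K).d | D.LamSite j (transl (0 : Site (F.P K) j) y)})
      (1 : B7Prop1Explicit.Site (F.P K).d → Fin (F.P K).d → (Matrix (Fin 2) (Fin 2) ℂ)ˣ) (pull A 0)) :
    ∀ φ : Matrix (Fin 2) (Fin 2) ℂ →ₗ[ℝ] ℝ,
      RE D ((F.L : ℝ) ^ (K - n)) (dsE ((F.L : ℝ) ^ (K - n)) (WithLp.toLp 2 (fun b => φ (A b)))) = 0 := by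
  have h := sliceMultiplier_of_isLandau138_pull D (((F.L : ℝ)⁻¹) ^ (K - n)) hLan
  rw [inv_invPow_eq] at h
  exact slice_of_matrixMultiplier D h

end Carrier

end Summit.QuantumFields.YangMills.Theorems.HalvingSliceDictionary

end
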